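import Literature.NumberTheory.Automorphic.LocalLanglandsGL
import Literature.NumberTheory.Automorphic.LocalConstantsUniquenessProofs
import HarnessLib

/-!
# `ε`-transport of the six-clause property `IsLocalLanglandsGL` (stub S1)

Stub S1 `stub_isLocalLanglandsGL_of_eps_artin_eq` of line `Sketch_18745_r1_k1` (idea
`reciprocity-rigidity`) for the crux `DyadicOddResidue.SectorComplement` (stmt-Langlands-18745).

Two systems of Deligne–Langlands local constants `𝓔 𝓔' : LocalEpsilonSystem F` with the same local
Artin data (`𝓔.artin = 𝓔'.artin`) define the same property `IsLocalLanglandsGL F … d 𝓔 rec` of a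
family `rec = (rec_n)_n`: of its six clauses only `epsilon_pairs` mentions `𝓔`, through the
`ε`-factor `epsilonWD … 𝓔 ψ μ r s = 𝓔.ε₀ F ψ μ (r ⊗ ω_s) · (Frobenius determinant factor)` at a
continuous non-trivial additive character `ψ` and an additive Haar measure `μ` of `F`, where
Deligne's uniqueness theorem (`localEpsilonSystem_unique_holds`, proved in the tree, taken at the
trivial extension `E := F`) identifies `𝓔.ε₀ F ψ μ` and `𝓔'.ε₀ F ψ μ`.

## References

* P. Deligne, *Les constantes des équations fonctionnelles des fonctions L*, in Modular functions
  of one variable II, LNM 349 (1973), Thm. 4.1 (uniqueness), §8.12. [Deligne1973]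
-/

noncomputable section

set_option linter.dupNamespace false

open scoped MatrixGroups
open MeasureTheory Literature.NumberTheory.Automorphic Literature.NumberTheory.GaloisRepresentations

namespace Summit.Langlands.Langlands.Theorems.ReciprocityRigidity

variable {F : Type} [Field F] [ValuativeRel F] [TopologicalSpace F] [IsNonarchimedeanLocalField F]

/-- **The `ε`-factor of a Weil–Deligne representation only depends on the local Artin data of the
system of local constants**: if `𝓔.artin = 𝓔'.artin` then
`ε((ρ, N), s, ψ, μ)` computed with `𝓔` and with `𝓔'` agree, for continuous non-trivial `ψ` and
Haar `μ` (Deligne's uniqueness theorem `localEpsilonSystem_unique_holds` at the trivial extension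
`E := F`, applied to the unramified twist `r ⊗ ω_s`; the Frobenius determinant factor does not
involve `𝓔`). [cite: Deligne1973, Thm. 4.1] -/
theorem epsilonWD_eq_of_artin_eq [MeasurableSpace F] [BorelSpace F]
    {V : Type} [AddCommGroup V] [Module ℂ V] [FiniteDimensional ℂ V]
    (hmul : IsFrobPow.mul (F := F)) (huniq : IsFrobPow.unique (F := F))
    (hn : absInertia_normal F) (hex : exists_isFrobPow (F := F))
    {𝓔 𝓔' : LocalEpsilonSystem F} (h𝓔 : 𝓔.artin = 𝓔'.artin)
    {ψ : AddChar F Circle} (hψ : ψ.IsContinuousNontrivial) (μ : Measure F) [μ.IsAddHaarMeasure]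
    (r : WeilDeligneRep F ℂ V) (s : ℂ) :
    epsilonWD hmul huniq hn hex 𝓔 ψ μ r s = epsilonWD hmul huniq hn hex 𝓔' ψ μ r s := by
  unfold epsilonWD
  rw [localEpsilonSystem_unique_holds 𝓔 𝓔' h𝓔 F ψ μ (r.unramifiedTwist hmul huniq s) hψ]

/-- **Stub S1 (`ε`-transport of the six-clause property).**  Two systems of local constants with
the same local Artin data give the same clause (iii-ε), hence `IsLocalLanglandsGL` for `𝓔'` implies
it for `𝓔`: the clauses `bijective`, `gl_one`, `lFactor_pairs`, `twist`, `centralChar` do not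
mention the system of local constants, and `epsilon_pairs` reads it only through
`epsilonWD … 𝓔 ψ μ (rec π ⊗ rec π') s` at a continuous non-trivial `ψ` and an additive Haar measure
`μ`, where `epsilonWD_eq_of_artin_eq` (Deligne 1973, Thm. 4.1, uniqueness — the proved
`localEpsilonSystem_unique_holds`) applies. [cite: Deligne1973, Thm. 4.1] -/
theorem stub_isLocalLanglandsGL_of_eps_artin_eq
    {hmul : @IsFrobPow.mul F _ _ _ _} {huniq : @IsFrobPow.unique F _ _ _ _}
    {hn : absInertia_normal F} {hex : @exists_isFrobPow F _ _ _ _}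
    {hns : @WeilGroup.exists_subgroup_le_inertia_isOpen_of_continuous F _ _ _ _}
    {d : LocalArtinData F} {𝓔 𝓔' : LocalEpsilonSystem F} (h𝓔 : 𝓔.artin = 𝓔'.artin)
    {rec : ∀ n : ℕ, IrrClass (GL (Fin n) F) → Quotient (frobSemisimpleWDSetoid F n)}
    (h : IsLocalLanglandsGL F hmul huniq hn hex hns d 𝓔' rec) :
    IsLocalLanglandsGL F hmul huniq hn hex hns d 𝓔 rec := by
  refine ⟨h.bijective, h.gl_one, h.lFactor_pairs, ?_, h.twist, h.centralChar⟩
  intro m n hm hmn π π' ψ hψ hg hg' _ _ μ _ hμ _ _ ν _ _ _ e a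
  rw [h.epsilon_pairs hm hmn π π' ψ hψ hg hg' μ hμ ν e a]
  refine forall_congr' fun s => ?_
  rw [epsilonWD_eq_of_artin_eq hmul huniq hn hex h𝓔 hψ μ _ s]

end Summit.Langlands.Langlands.Theorems.ReciprocityRigidity

end
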